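import Summits.CriticalPhenomena.PercolationContinuityZ3.Theorems.SahiPairwiseTP2LineConnectedDefs

/-!
# Pairwise TP₂ implies MTP₂ for kernels with line-connected sublattice support — part 1 (staircases and the join grid)

Support file of the Sahi cell (`prim-sahi`, literature seat, generation 45; `--supports stmt-CriticalPhenomena-4575`);
second of three parts of the staged file `SahiPairwiseTP2LineConnected.lean` (sha256 `2e5be9b26063f148…`; see
`Theorems/SahiPairwiseTP2LineConnectedDefs.lean` for the layout and `Theorems/SahiPairwiseTP2LineConnected.lean` for the
full mathematical header).  Here: the monotone staircase lemma (`exists_monotone_staircase`), the grid of joins of two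
staircases and its telescoping (`grid_step`, `column`), **`isLogSupermodular_of_pairwiseTP2_of_isLineConnected`**
(`μ ≥ 0` with `⊓`/`⊔`-closed line-connected support and TP₂ in every pair of variables is MTP₂),
`inf_sup_mem_support_of_isLogSupermodular` (an MTP₂ kernel has sublattice support) and the strictly positive case
`S = univ` (Karlin–Rinott, J. Multivariate Anal. 10 (1980), p. 468) as an instance.  Declarations byte-identical to the
staged file, same order, same namespace.

No sorries, no new axioms.
-/

namespace Summit.CriticalPhenomena.PercolationContinuityZ3.Theorems.PairwiseTP2LineConnected

open Function Relation
open Literature.Probability.LatticeModels.FKGEqualityChains (IsLogSupermodular)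
open Literature.Probability.LatticeModels.MTP2PairwiseCriterion (IsPairwiseTP2)

variable {ι : Type*} {α : ι → Type*} [DecidableEq ι] [∀ i, LinearOrder (α i)]

/-! ### Chains of line-adjacent points -/

omit [DecidableEq ι] in
/-- The endpoint of a monotone chain lies above its start. [folklore] -/
theorem le_of_reflTransGen_monoAdj {S : Set (∀ i, α i)} {a b : ∀ i, α i} (h : ReflTransGen (MonoAdj S) a b) :
    a ≤ b := by
  induction h with
  | refl => exact le_rfl
  | tail _ hbc ih => exact ih.trans hbc.2.2.1

omit [DecidableEq ι] in
/-- The endpoint of a non-trivial monotone chain lies in `S`; with the start in `S`, every endpoint does. [folklore] -/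
theorem mem_of_reflTransGen_monoAdj {S : Set (∀ i, α i)} {a b : ∀ i, α i} (ha : a ∈ S)
    (h : ReflTransGen (MonoAdj S) a b) : b ∈ S := by
  induction h with
  | refl => exact ha
  | tail _ hbc _ => exact hbc.2.1

/-! ### Monotone staircases -/

omit [DecidableEq ι] in
/-- **Monotone staircase lemma.** In a `⊓`/`⊔`-closed set `S`, if `x ≤ y` are joined by a chain of points of `S` with
consecutive points on a common axis-parallel line, then they are joined by such a chain which is moreover MONOTONE
(each step raises one coordinate).  Construction: follow the chain `z₀ = x, z₁, …`, replacing `z_k` by the running join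
`w_k = w_{k-1} ⊔ (z_k ⊓ y)`; then `w_k ∈ S`, `x ≤ w_k ≤ y`, consecutive `w`'s differ in at most the coordinate in which
the `z`'s do, and the last `w` is `y`. [this work] -/
theorem exists_monotone_staircase {S : Set (∀ i, α i)}
    (hinf : ∀ a ∈ S, ∀ b ∈ S, a ⊓ b ∈ S) (hsup : ∀ a ∈ S, ∀ b ∈ S, a ⊔ b ∈ S)
    {x y : ∀ i, α i} (hx : x ∈ S) (hy : y ∈ S) (hxy : x ≤ y) (h : ReflTransGen (LineAdj S) x y) :
    ReflTransGen (MonoAdj S) x y := by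
  suffices H : ∀ z, ReflTransGen (LineAdj S) x z →
      ∃ w, w ∈ S ∧ z ⊓ y ≤ w ∧ w ≤ y ∧ ReflTransGen (MonoAdj S) x w by
    obtain ⟨w, -, hyw, hwy, hp⟩ := H y h
    have hw : w = y := le_antisymm hwy (by simpa using hyw)
    exact hw ▸ hp
  intro z hz
  induction hz with
  | refl => exact ⟨x, hx, inf_le_left, hxy, ReflTransGen.refl⟩
  | @tail b c _ hbc ih =>
    obtain ⟨w, hwS, hbw, hwy, hp⟩ := ih
    obtain ⟨-, hcS, i, hi⟩ := hbc
    have hw'S : w ⊔ (c ⊓ y) ∈ S := hsup _ hwS _ (hinf _ hcS _ hy)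
    refine ⟨w ⊔ (c ⊓ y), hw'S, le_sup_right, sup_le hwy inf_le_right, hp.tail ⟨hwS, hw'S, le_sup_left, i, ?_⟩⟩
    intro j hj
    have hle : (c ⊓ y) j ≤ w j := by
      have := hbw j
      rw [Pi.inf_apply] at this ⊢
      rwa [← hi j hj]
    rw [Pi.sup_apply]
    exact (sup_eq_left.2 hle).symm

/-! ### The grid of joins of two staircases: every cell is a pairwise TP₂ instance -/

/-- **Grid step.**  Let `u = x ⊓ y`, `u ≤ p ≤ p' ≤ x` with `p, p'` on a common axis-parallel line, and
`u ≤ q ≤ q' ≤ y` likewise.  Then `μ (p' ⊔ q) μ (p ⊔ q') ≤ μ (p ⊔ q) μ (p' ⊔ q')` for every pairwise TP₂ kernel `μ`: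
the four joins are the corners of a two-coordinate rectangle based at `p ⊔ q` (the two moving coordinates are distinct
because one lies where `x > y` and the other where `y > x`). [this work] -/
theorem grid_step {μ : (∀ i, α i) → ℝ} (h : IsPairwiseTP2 μ) {x y p p' q q' : ∀ i, α i}
    (hup : x ⊓ y ≤ p) (hpp' : p ≤ p') (hp'x : p' ≤ x) (huq : x ⊓ y ≤ q) (hqq' : q ≤ q') (hq'y : q' ≤ y)
    {i j : ι} (hi : ∀ k, k ≠ i → p k = p' k) (hj : ∀ k, k ≠ j → q k = q' k) :
    μ (p' ⊔ q) * μ (p ⊔ q') ≤ μ (p ⊔ q) * μ (p' ⊔ q') := by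
  by_cases hpi : p i = p' i
  · have hpp : p = p' := funext fun k => if hk : k = i then hk ▸ hpi else hi k hk
    subst hpp
    exact le_rfl
  by_cases hqj : q j = q' j
  · have hqq : q = q' := funext fun k => if hk : k = j then hk ▸ hqj else hj k hk
    subst hqq
    exact (mul_comm (μ (p' ⊔ q)) (μ (p ⊔ q))).le
  have hpi' : p i < p' i := lt_of_le_of_ne (hpp' i) hpi
  have hqj' : q j < q' j := lt_of_le_of_ne (hqq' j) hqj
  -- the coordinate `i` is one where `y < x`, the coordinate `j` one where `x < y`
  have hyx : y i < x i := by
    have h1 : (x ⊓ y) i < x i := lt_of_lt_of_le (lt_of_le_of_lt (hup i) hpi') (hp'x i)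
    rw [Pi.inf_apply] at h1
    by_contra hle
    rw [not_lt] at hle
    rw [inf_eq_left.2 hle] at h1
    exact lt_irrefl _ h1
  have hxy : x j < y j := by
    have h1 : (x ⊓ y) j < y j := lt_of_lt_of_le (lt_of_le_of_lt (huq j) hqj') (hq'y j)
    rw [Pi.inf_apply] at h1
    by_contra hle
    rw [not_lt] at hle
    rw [inf_eq_right.2 hle] at h1
    exact lt_irrefl _ h1
  have hij : i ≠ j := by
    rintro rfl
    exact lt_asymm hyx hxy
  -- values of `q, q'` at `i` and of `p, p'` at `j`
  have hqi : q i ≤ p i := by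
    have h1 : q i ≤ y i := (hqq' i).trans (hq'y i)
    have h2 : (x ⊓ y) i ≤ p i := hup i
    rw [Pi.inf_apply, inf_eq_right.2 hyx.le] at h2
    exact h1.trans h2
  have hq'i : q' i = q i := (hj i hij).symm
  have hpj : p j ≤ q j := by
    have h1 : p j ≤ x j := (hpp' j).trans (hp'x j)
    have h2 : (x ⊓ y) j ≤ q j := huq j
    rw [Pi.inf_apply, inf_eq_left.2 hxy.le] at h2
    exact h1.trans h2
  have hp'j : p' j = p j := (hi j hij.symm).symm
  -- the four corners as updates of the base `B = p ⊔ q`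
  set B := p ⊔ q with hB
  have hBi : B i = p i := by rw [hB, Pi.sup_apply]; exact sup_eq_left.2 hqi
  have hBj : B j = q j := by rw [hB, Pi.sup_apply]; exact sup_eq_right.2 hpj
  have e1 : p' ⊔ q = update (update B i (p' i)) j (q j) := by
    funext k
    by_cases hkj : k = j
    · subst hkj
      rw [update_self, Pi.sup_apply, hp'j]
      exact sup_eq_right.2 hpj
    · rw [update_of_ne hkj]
      by_cases hki : k = i
      · subst hki
        rw [update_self, Pi.sup_apply]
        exact sup_eq_left.2 (hqi.trans (hpp' k))
      · rw [update_of_ne hki, hB, Pi.sup_apply, Pi.sup_apply, hi k hki]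
  have e2 : p ⊔ q' = update (update B i (p i)) j (q' j) := by
    funext k
    by_cases hkj : k = j
    · subst hkj
      rw [update_self, Pi.sup_apply]
      exact sup_eq_right.2 (hpj.trans (hqq' k))
    · rw [update_of_ne hkj]
      by_cases hki : k = i
      · subst hki
        rw [update_self, Pi.sup_apply, hq'i]
        exact sup_eq_left.2 hqi
      · rw [update_of_ne hki, hB, Pi.sup_apply, Pi.sup_apply, hj k hkj]
  have e3 : p ⊔ q = update (update B i (p i)) j (q j) := by
    rw [← hBi, update_eq_self, ← hBj, update_eq_self]
  have e4 : p' ⊔ q' = update (update B i (p' i)) j (q' j) := by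
    funext k
    by_cases hkj : k = j
    · subst hkj
      rw [update_self, Pi.sup_apply, hp'j]
      exact sup_eq_right.2 (hpj.trans (hqq' k))
    · rw [update_of_ne hkj]
      by_cases hki : k = i
      · subst hki
        rw [update_self, Pi.sup_apply, hq'i]
        exact sup_eq_left.2 (hqi.trans (hpp' k))
      · rw [update_of_ne hki, hB, Pi.sup_apply, Pi.sup_apply, hi k hki, hj k hkj]
  have key := h B i j hij (p i) (p' i) (q j) (q' j) hpi'.le hqj'.le
  rw [← e1, ← e2, ← e3, ← e4] at key
  exact key

/-! ### Telescoping along the grid -/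

/-- **One column of the grid.**  For a monotone staircase `u = x ⊓ y → … → p` below `x` and one monotone step
`q → q'` below `y` (all in the `⊔`-closed support of `μ ≥ 0`), the cross ratio telescopes:
`μ (p ⊔ q) μ (u ⊔ q') ≤ μ (u ⊔ q) μ (p ⊔ q')`. [this work] -/
theorem column {μ : (∀ i, α i) → ℝ} (h0 : ∀ z, 0 ≤ μ z) (h : IsPairwiseTP2 μ)
    (hsup : ∀ a b, μ a ≠ 0 → μ b ≠ 0 → μ (a ⊔ b) ≠ 0)
    {x y q q' : ∀ i, α i} (huq : x ⊓ y ≤ q) (hqq' : q ≤ q') (hq'y : q' ≤ y) {j : ι}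
    (hj : ∀ k, k ≠ j → q k = q' k) (hq'S : μ q' ≠ 0)
    {p : ∀ i, α i} (hpath : ReflTransGen (MonoAdj {z | μ z ≠ 0}) (x ⊓ y) p) (hpx : p ≤ x) :
    μ (p ⊔ q) * μ (x ⊓ y ⊔ q') ≤ μ (x ⊓ y ⊔ q) * μ (p ⊔ q') := by
  induction hpath with
  | refl => exact le_rfl
  | @tail b c hab hbc ih =>
    obtain ⟨hbS, -, hble, i, hi⟩ := hbc
    have ih' := ih (hble.trans hpx)
    have g := grid_step h (le_of_reflTransGen_monoAdj hab) hble hpx huq hqq' hq'y hi hj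
    have hpos : 0 < μ (b ⊔ q') := lt_of_le_of_ne (h0 _) (hsup b q' hbS hq'S).symm
    have key : μ (c ⊔ q) * μ (x ⊓ y ⊔ q') * μ (b ⊔ q') ≤ μ (x ⊓ y ⊔ q) * μ (c ⊔ q') * μ (b ⊔ q') :=
      calc μ (c ⊔ q) * μ (x ⊓ y ⊔ q') * μ (b ⊔ q')
          = (μ (c ⊔ q) * μ (b ⊔ q')) * μ (x ⊓ y ⊔ q') := by ring
        _ ≤ (μ (b ⊔ q) * μ (c ⊔ q')) * μ (x ⊓ y ⊔ q') := mul_le_mul_of_nonneg_right g (h0 _)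
        _ = (μ (b ⊔ q) * μ (x ⊓ y ⊔ q')) * μ (c ⊔ q') := by ring
        _ ≤ (μ (x ⊓ y ⊔ q) * μ (b ⊔ q')) * μ (c ⊔ q') := mul_le_mul_of_nonneg_right ih' (h0 _)
        _ = μ (x ⊓ y ⊔ q) * μ (c ⊔ q') * μ (b ⊔ q') := by ring
    exact le_of_mul_le_mul_right key hpos

/-- **Pairwise TP₂ ⟹ MTP₂ for kernels whose support is a line-connected sublattice.**  Let `μ ≥ 0` on a finite
product of chains, with support `{μ ≠ 0}` closed under `⊓` and `⊔` and line-connected (any two support points are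
joined through support points, consecutive ones on a common axis-parallel line).  If `μ` is TP₂ in every pair of
variables with the other variables held fixed, then `μ` satisfies the FKG lattice condition
`μ x μ y ≤ μ (x ⊓ y) μ (x ⊔ y)` for ALL `x, y`.  This contains Karlin–Rinott's strictly positive case
(`isLogSupermodular_of_pairwiseTP2`, support `= univ`) and the interval-support case [FallatEtAl2017, Prop. 3.5], and
proves the conjecture stated after [FallatEtAl2017, Prop. 3.5] for all supports closed under `⊓`, `⊔` — the only
supports an MTP₂ kernel can have (`inf_sup_mem_support_of_isLogSupermodular`). [this work] -/
theorem isLogSupermodular_of_pairwiseTP2_of_isLineConnected {μ : (∀ i, α i) → ℝ} (h0 : ∀ z, 0 ≤ μ z)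
    (hconn : IsLineConnected {z | μ z ≠ 0})
    (hinf : ∀ a b, μ a ≠ 0 → μ b ≠ 0 → μ (a ⊓ b) ≠ 0) (hsup : ∀ a b, μ a ≠ 0 → μ b ≠ 0 → μ (a ⊔ b) ≠ 0)
    (h : IsPairwiseTP2 μ) : IsLogSupermodular μ := by
  intro x y
  by_cases hx : μ x = 0
  · rw [hx, zero_mul]; exact mul_nonneg (h0 _) (h0 _)
  by_cases hy : μ y = 0
  · rw [hy, mul_zero]; exact mul_nonneg (h0 _) (h0 _)
  have hu : μ (x ⊓ y) ≠ 0 := hinf x y hx hy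
  have hinf' : ∀ a ∈ {z | μ z ≠ 0}, ∀ b ∈ {z | μ z ≠ 0}, a ⊓ b ∈ {z | μ z ≠ 0} :=
    fun a ha b hb => hinf a b ha hb
  have hsup' : ∀ a ∈ {z | μ z ≠ 0}, ∀ b ∈ {z | μ z ≠ 0}, a ⊔ b ∈ {z | μ z ≠ 0} :=
    fun a ha b hb => hsup a b ha hb
  -- monotone staircases from `x ⊓ y` to `x` and to `y`
  have hP : ReflTransGen (MonoAdj {z | μ z ≠ 0}) (x ⊓ y) x :=
    exists_monotone_staircase hinf' hsup' hu hx inf_le_left (hconn _ hu _ hx)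
  have hQ : ReflTransGen (MonoAdj {z | μ z ≠ 0}) (x ⊓ y) y :=
    exists_monotone_staircase hinf' hsup' hu hy inf_le_right (hconn _ hu _ hy)
  -- telescoping along the second staircase; invariant `μ x μ (u ⊔ q) ≤ μ u μ (x ⊔ q)`
  suffices H : ∀ q, ReflTransGen (MonoAdj {z | μ z ≠ 0}) (x ⊓ y) q → q ≤ y →
      μ x * μ (x ⊓ y ⊔ q) ≤ μ (x ⊓ y) * μ (x ⊔ q) by
    have := H y hQ le_rfl
    rwa [sup_eq_right.2 (inf_le_right : x ⊓ y ≤ y)] at this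
  intro q hq hqy
  induction hq with
  | refl =>
    rw [sup_idem, sup_eq_left.2 (inf_le_left : x ⊓ y ≤ x), mul_comm]
  | @tail b c hab hbc ih =>
    obtain ⟨hbS, hcS, hble, j, hj⟩ := hbc
    have ih' := ih (hble.trans hqy)
    have hub : x ⊓ y ≤ b := le_of_reflTransGen_monoAdj hab
    have col := column h0 h hsup hub hble hqy hj hcS hP le_rfl
    -- col : μ (x ⊔ b) * μ (x ⊓ y ⊔ c) ≤ μ (x ⊓ y ⊔ b) * μ (x ⊔ c)
    have hpos1 : 0 < μ (x ⊓ y ⊔ b) := by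
      rw [sup_eq_right.2 hub]; exact lt_of_le_of_ne (h0 _) (Ne.symm hbS)
    have hpos2 : 0 < μ (x ⊔ b) := lt_of_le_of_ne (h0 _) (hsup x b hx hbS).symm
    have key : μ x * μ (x ⊓ y ⊔ c) * (μ (x ⊓ y ⊔ b) * μ (x ⊔ b)) ≤
        μ (x ⊓ y) * μ (x ⊔ c) * (μ (x ⊓ y ⊔ b) * μ (x ⊔ b)) :=
      calc μ x * μ (x ⊓ y ⊔ c) * (μ (x ⊓ y ⊔ b) * μ (x ⊔ b))
          = (μ x * μ (x ⊓ y ⊔ b)) * (μ (x ⊔ b) * μ (x ⊓ y ⊔ c)) := by ring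
        _ ≤ (μ (x ⊓ y) * μ (x ⊔ b)) * (μ (x ⊓ y ⊔ b) * μ (x ⊔ c)) :=
            mul_le_mul ih' col (mul_nonneg (h0 _) (h0 _)) (mul_nonneg (h0 _) (h0 _))
        _ = μ (x ⊓ y) * μ (x ⊔ c) * (μ (x ⊓ y ⊔ b) * μ (x ⊔ b)) := by ring
    exact le_of_mul_le_mul_right key (mul_pos hpos1 hpos2)

omit [DecidableEq ι] in
/-- The support of an MTP₂ kernel `μ ≥ 0` is closed under `⊓` and `⊔` ("its support is always a sublattice",
Lauritzen–Uhler–Zwiernik 2021 §3; the hypotheses `hinf`, `hsup` above are therefore necessary for the conclusion).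
[folklore] -/
theorem inf_sup_mem_support_of_isLogSupermodular {μ : (∀ i, α i) → ℝ} (h0 : ∀ z, 0 ≤ μ z)
    (h : IsLogSupermodular μ) {a b : ∀ i, α i} (ha : μ a ≠ 0) (hb : μ b ≠ 0) :
    μ (a ⊓ b) ≠ 0 ∧ μ (a ⊔ b) ≠ 0 := by
  have hab : 0 < μ a * μ b := mul_pos (lt_of_le_of_ne (h0 _) ha.symm) (lt_of_le_of_ne (h0 _) hb.symm)
  have key := lt_of_lt_of_le hab (h a b)
  constructor
  · intro h1; rw [h1, zero_mul] at key; exact lt_irrefl _ key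
  · intro h1; rw [h1, mul_zero] at key; exact lt_irrefl _ key

/-! ### The strictly positive case is the case `S = univ` -/

section Fintype

variable [Fintype ι]

omit [∀ i, LinearOrder (α i)] in
/-- Any two configurations are joined by changing one coordinate at a time; so a full support is line-connected.
[folklore] -/
theorem isLineConnected_univ : IsLineConnected (Set.univ : Set (∀ i, α i)) := by
  intro x _ y _
  -- `m s` = `y` on `s`, `x` off `s`
  suffices H : ∀ s : Finset ι, ReflTransGen (LineAdj (Set.univ : Set (∀ i, α i))) x
      (fun i => if i ∈ s then y i else x i) by
    have := H Finset.univ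
    simpa using this
  intro s
  induction s using Finset.induction_on with
  | empty => simp only [Finset.notMem_empty, if_false]; exact ReflTransGen.refl
  | insert i s his ih =>
    refine ih.tail ⟨Set.mem_univ _, Set.mem_univ _, i, fun j hj => ?_⟩
    simp [Finset.mem_insert, hj]

omit [∀ i, LinearOrder (α i)] in
/-- A strictly positive kernel has line-connected support. [folklore] -/
theorem isLineConnected_of_forall_ne_zero {μ : (∀ i, α i) → ℝ} (hpos : ∀ z, μ z ≠ 0) :
    IsLineConnected {z | μ z ≠ 0} := by
  have : {z | μ z ≠ 0} = Set.univ := Set.eq_univ_of_forall hpos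
  rw [this]; exact isLineConnected_univ

/-- Sanity check: the strictly positive case (Karlin–Rinott 1980, p. 468; in the tree as
`MTP2PairwiseCriterion.isLogSupermodular_of_pairwiseTP2`) is an instance of the line-connected theorem. -/
example {μ : (∀ i, α i) → ℝ} (hpos : ∀ z, 0 < μ z) (h : IsPairwiseTP2 μ) : IsLogSupermodular μ :=
  isLogSupermodular_of_pairwiseTP2_of_isLineConnected (fun z => (hpos z).le)
    (isLineConnected_of_forall_ne_zero fun z => (hpos z).ne')
    (fun _ _ _ _ => (hpos _).ne') (fun _ _ _ _ => (hpos _).ne') h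

end Fintype

end Summit.CriticalPhenomena.PercolationContinuityZ3.Theorems.PairwiseTP2LineConnected
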